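import Summits.QuantumFields.YangMills.Theorems.UnitScaleTiltProp7GeodesicInterp
import HarnessLib

/-!
# Route `UnitScaleTilt`, crux K1 child «MinimiserStabilityRegPr» (stmt-QuantumFields-19200), registered stub `stub_prop7From14` (skeleton birth_v7
# cc37a178…; leaf V3 «Prop 7 from a background (14)») — THE GEODESIC TRILINEAR BLEND OF EIGHT NEARBY UNITARIES: membership, corner ∕ face values,
# equivariance, Lipschitz bounds in the weights and in the inputs, for ANY two-point interpolation scheme `G` with the properties of `Prop7GeodesicInterp`

Cell `ym3-torus` ∕ fleet seat `ym-ust-19200-p1` (gen 9; HUMAN RULING D-0037, YM ladder rung R3).  WHY.  Brick 2 of the blended-comb-gauge line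
(CARD-19200-V3-g9.md) for clause 1 of [Balaban1985Variational] Prop. 7 at the T³ carrier: the (4)-gauge transformation of the line is, at a site `z`,
the TRILINEAR BLEND `B(t(z); v(z))` of the eight comb-axial elements `v_y(z) = U₀(Γ_{y,z})⁻¹W(Γ_{y,z})` ([Balaban1985Variational] (18), gen 7
`Prop7AxialGauge`) of the `2³` block centres `y` surrounding `z`, weights `t(z) ∈ [0,1]³` = fractional position of `z` in the cell of centres.  Along a
bond the eight elements move by ONE simultaneous two-sided translation `v ↦ U₀,b⁻¹·v·W_b` up to the comb-gauge error `O((ε₀ + e₀)η)`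
([Balaban1985RegularSpaces] Lemma 1, gen 7 `Prop7AxialGaugeSup`), the weights by `η = L^{−k}`, and the eight elements are pairwise `O(ε₀ + e₀)`-close (gen 7
`Prop7AxialGaugeFace`): the estimates below then bound the blended bond variable by `O((ε₀ + e₀)η)` on EVERY bond.  Stated for an ABSTRACT two-point
scheme `G : ℝ → M → M → M` under the hypotheses certified for the geodesic arc in `Prop7GeodesicInterp` (no definition is introduced).

WHAT IS PROVED (sorry-free, no definition; `d(X, Y) := ‖XY* − 1‖` on unitaries, `L²`-operator norm).
§1 The relative distance on `U(N)`: `udist_symm`, `udist_triangle`, `udist_conj`, `udist_left_mul` (`d(pa, a) = ‖p − 1‖`).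
§2 One level: `level_diam` (`d(G_t(a,b), G_t(a′,b′)) ≤ 13D` if all four inputs are pairwise `D`-close), `level_pert` (inputs moved by `ρ` on the left ⟹
   output moves by `≤ 16ρ`).
§3 The blend `B(t; v) = G_{t₃}(G_{t₂}(G_{t₁}(v₀₀₀,v₁₀₀), G_{t₁}(v₀₁₀,v₁₁₀)), G_{t₂}(G_{t₁}(v₀₀₁,v₁₀₁), G_{t₁}(v₀₁₁,v₁₁₁)))` of eight pairwise `D`-close
   unitaries: `blend_mem_unitaryGroup` ∕ `blend_mem_specialUnitaryGroup`; the six FACE VALUES `blend_face₁₀` … `blend_face₃₁` (at `tᵢ ∈ {0, 1}` the blend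
   is the bilinear blend of the corresponding four corners — continuity across the cells of centres) and `blend_corner` (`t = 0 ⟹ B = v₀₀₀`: the blend
   is `1` at a centre where the comb element is `1`, i.e. the blend lies in the group (4)); **`blend_conj`** (equivariance under `v ↦ u·v·w`);
   **`blend_lip_weights`** (`d(B(t;v), B(t′;v)) ≤ 1600(|t₁−t₁′| + |t₂−t₂′| + |t₃−t₃′|)·D`); **`blend_lip_inputs`** (`d(vα′, vα) ≤ ρ ∀α ⟹
   d(B(t;v′), B(t;v)) ≤ 4096ρ`).

HONEST SCOPE.  Elementary; no statement of [Balaban1985Variational] is proved here; count-neutral helper toward stmt-QuantumFields-19200 (`--supports`).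

References: T. Bałaban, CMP 102 (1985) 277–309 [Balaban1985Variational] ((4) p.278, (18) p.280); CMP 99 (1985) 75–102 [Balaban1985RegularSpaces]
(Lemma 1 p.79, p.80); CMP 98 (1985) 17–51 [Balaban1985Averaging] ((19)–(27) pp.21–22).
-/

noncomputable section

open NormedSpace
open scoped Matrix.Norms.L2Operator

namespace Summit.QuantumFields.YangMills.Theorems.Prop7GeodesicBlend

open Literature.MathematicalPhysics.QuantumFieldTheory.Balaban1983to89
open Summit.QuantumFields.YangMills.Theorems.Prop7GeodesicInterp (norm_conj_sub_one)

variable {n : Type*} [Fintype n] [DecidableEq n]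

/-! ## §1 The relative distance `d(X,Y) = ‖XY* − 1‖` on `U(N)` -/

section UDist

/-- Symmetry: `‖XY* − 1‖ = ‖YX* − 1‖`. [cite: Balaban1985Averaging, (19) p.21] -/
theorem udist_symm (X Y : Matrix n n ℂ) : ‖X * star Y - 1‖ = ‖Y * star X - 1‖ := by
  rw [← ExpMeanLog.norm_star_sub_one (X * star Y), star_mul, star_star]

/-- Triangle inequality: `‖XZ* − 1‖ ≤ ‖XY* − 1‖ + ‖YZ* − 1‖` for unitary `X`, `Y`. [cite: Balaban1985Averaging, (19) p.21] -/
theorem udist_triangle {X Y : Matrix n n ℂ} (hX : X ∈ Matrix.unitaryGroup n ℂ) (hY : Y ∈ Matrix.unitaryGroup n ℂ) (Z : Matrix n n ℂ) :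
    ‖X * star Z - 1‖ ≤ ‖X * star Y - 1‖ + ‖Y * star Z - 1‖ := by
  have h : X * star Z - 1 = (X * star Y) * (Y * star Z - 1) + (X * star Y - 1) := by
    have hY' : star Y * Y = 1 := Unitary.star_mul_self_of_mem hY
    rw [mul_sub, mul_one, sub_add_sub_cancel, mul_assoc X (star Y), ← mul_assoc (star Y) Y, hY', one_mul]
  rw [h]
  have hXY : X * star Y ∈ Matrix.unitaryGroup n ℂ := Submonoid.mul_mem _ hX (Unitary.star_mem hY)
  calc ‖(X * star Y) * (Y * star Z - 1) + (X * star Y - 1)‖ ≤ ‖(X * star Y) * (Y * star Z - 1)‖ + ‖X * star Y - 1‖ := norm_add_le _ _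
    _ = ‖Y * star Z - 1‖ + ‖X * star Y - 1‖ := by rw [CStarRing.norm_mem_unitary_mul _ hXY]
    _ = ‖X * star Y - 1‖ + ‖Y * star Z - 1‖ := add_comm _ _

/-- Invariance under two-sided unitary translation: `‖(uXw)(uYw)* − 1‖ = ‖XY* − 1‖`. [cite: Balaban1985Averaging, (19) p.21] -/
theorem udist_conj {u w : Matrix n n ℂ} (hu : u ∈ Matrix.unitaryGroup n ℂ) (hw : w ∈ Matrix.unitaryGroup n ℂ) (X Y : Matrix n n ℂ) :
    ‖(u * X * w) * star (u * Y * w) - 1‖ = ‖X * star Y - 1‖ := by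
  have h : (u * X * w) * star (u * Y * w) = u * (X * star Y) * star u := by
    simp only [star_mul, mul_assoc]
    rw [← mul_assoc w (star w), Unitary.mul_star_self_of_mem hw, one_mul]
  rw [h, norm_conj_sub_one hu]

/-- `‖(pa)a* − 1‖ = ‖p − 1‖` for unitary `a`. [folklore] -/
theorem udist_left_mul {a : Matrix n n ℂ} (ha : a ∈ Matrix.unitaryGroup n ℂ) (p : Matrix n n ℂ) : ‖(p * a) * star a - 1‖ = ‖p - 1‖ := by
  rw [mul_assoc, Unitary.mul_star_self_of_mem ha, mul_one]

/-- `a′ = (a′a*)·a` for unitary `a`. [folklore] -/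
theorem eq_udiff_mul {a : Matrix n n ℂ} (ha : a ∈ Matrix.unitaryGroup n ℂ) (a' : Matrix n n ℂ) : a' = (a' * star a) * a := by
  rw [mul_assoc, Unitary.star_mul_self_of_mem ha, mul_one]

/-- `a′a*` is unitary for unitary `a`, `a′`. [folklore] -/
theorem udiff_mem {a a' : Matrix n n ℂ} (ha : a ∈ Matrix.unitaryGroup n ℂ) (ha' : a' ∈ Matrix.unitaryGroup n ℂ) :
    a' * star a ∈ Matrix.unitaryGroup n ℂ :=
  Submonoid.mul_mem _ ha' (Unitary.star_mem ha)

end UDist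

/-! ## §2 One interpolation level -/

section Level

variable (G : ℝ → Matrix n n ℂ → Matrix n n ℂ → Matrix n n ℂ)

/-- **DIAMETER PROPAGATION THROUGH ONE LEVEL**: if `a, b, a′, b′` are unitary and pairwise `D`-close (`D ≤ 1/3`) and `G` keeps `G_t(a,b)` within
`6|t|·‖ba* − 1‖` of `a`, then `d(G_t(a,b), G_t(a′,b′)) ≤ 13D` for `t ∈ [0,1]`. [cite: Balaban1985Averaging, (24)-(27) pp.21-22] -/
theorem level_diam
    (hmem : ∀ (t : ℝ) (a b : Matrix n n ℂ), a ∈ Matrix.unitaryGroup n ℂ → b ∈ Matrix.unitaryGroup n ℂ → ‖b * star a - 1‖ ≤ 1 / 3 →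
      G t a b ∈ Matrix.unitaryGroup n ℂ)
    (hnear : ∀ (t : ℝ) (a b : Matrix n n ℂ), a ∈ Matrix.unitaryGroup n ℂ → b ∈ Matrix.unitaryGroup n ℂ → ‖b * star a - 1‖ ≤ 1 / 3 → |t| ≤ 1 →
      ‖G t a b * star a - 1‖ ≤ 6 * |t| * ‖b * star a - 1‖)
    {a b a' b' : Matrix n n ℂ} (ha : a ∈ Matrix.unitaryGroup n ℂ) (hb : b ∈ Matrix.unitaryGroup n ℂ) (ha' : a' ∈ Matrix.unitaryGroup n ℂ)
    (hb' : b' ∈ Matrix.unitaryGroup n ℂ) {D : ℝ} (hD : D ≤ 1 / 3) (hab : ‖b * star a - 1‖ ≤ D) (hab' : ‖b' * star a' - 1‖ ≤ D)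
    (haa' : ‖a * star a' - 1‖ ≤ D) {t : ℝ} (ht0 : 0 ≤ t) (ht1 : t ≤ 1) :
    ‖G t a b * star (G t a' b') - 1‖ ≤ 13 * D := by
  have hD0 : 0 ≤ D := (norm_nonneg _).trans hab
  have htabs : |t| ≤ 1 := by rw [abs_of_nonneg ht0]; exact ht1
  have ht6 : 6 * |t| ≤ 6 := by rw [abs_of_nonneg ht0]; linarith
  have h1 : ‖G t a b * star a - 1‖ ≤ 6 * D :=
    (hnear t a b ha hb (hab.trans hD) htabs).trans (by nlinarith [norm_nonneg (b * star a - 1)])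
  have h3 : ‖a' * star (G t a' b') - 1‖ ≤ 6 * D := by
    rw [udist_symm]
    exact (hnear t a' b' ha' hb' (hab'.trans hD) htabs).trans (by nlinarith [norm_nonneg (b' * star a' - 1)])
  have hG : G t a b ∈ Matrix.unitaryGroup n ℂ := hmem t a b ha hb (hab.trans hD)
  calc ‖G t a b * star (G t a' b') - 1‖ ≤ ‖G t a b * star a - 1‖ + ‖a * star (G t a' b') - 1‖ := udist_triangle hG ha _
    _ ≤ ‖G t a b * star a - 1‖ + (‖a * star a' - 1‖ + ‖a' * star (G t a' b') - 1‖) := by gcongr; exact udist_triangle ha ha' _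
    _ ≤ 6 * D + (D + 6 * D) := by gcongr
    _ = 13 * D := by ring

/-- **ONE LEVEL UNDER A CHANGE OF INPUTS**: unitary `a, b, a′, b′` with `‖ba* − 1‖ ≤ 1/6`, `d(a′, a) ≤ ρ`, `d(b′, b) ≤ ρ`, `ρ ≤ 1/16`, `t ∈ [0,1]`:
`d(G_t(a′,b′), G_t(a,b)) ≤ 16ρ` (write `a′ = (a′a*)a`, `b′ = (b′b*)b`). [cite: Balaban1985Averaging, (21)-(27) pp.21-22] -/
theorem level_pert
    (hpert : ∀ (t : ℝ) (a b p q : Matrix n n ℂ), a ∈ Matrix.unitaryGroup n ℂ → b ∈ Matrix.unitaryGroup n ℂ →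
      p ∈ Matrix.unitaryGroup n ℂ → q ∈ Matrix.unitaryGroup n ℂ → ‖b * star a - 1‖ ≤ 1 / 6 → ‖p - 1‖ ≤ 1 / 16 → ‖q - 1‖ ≤ 1 / 16 →
      0 ≤ t → t ≤ 1 → ‖G t (p * a) (q * b) * star (G t a b) - 1‖ ≤ 8 * (‖p - 1‖ + ‖q - 1‖))
    {a b a' b' : Matrix n n ℂ} (ha : a ∈ Matrix.unitaryGroup n ℂ) (hb : b ∈ Matrix.unitaryGroup n ℂ) (ha' : a' ∈ Matrix.unitaryGroup n ℂ)
    (hb' : b' ∈ Matrix.unitaryGroup n ℂ) (hab : ‖b * star a - 1‖ ≤ 1 / 6) {ρ : ℝ} (hρ : ρ ≤ 1 / 16)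
    (haa : ‖a' * star a - 1‖ ≤ ρ) (hbb : ‖b' * star b - 1‖ ≤ ρ) {t : ℝ} (ht0 : 0 ≤ t) (ht1 : t ≤ 1) :
    ‖G t a' b' * star (G t a b) - 1‖ ≤ 16 * ρ := by
  have hp : a' * star a ∈ Matrix.unitaryGroup n ℂ := udiff_mem ha ha'
  have hq : b' * star b ∈ Matrix.unitaryGroup n ℂ := udiff_mem hb hb'
  rw [eq_udiff_mul ha a', eq_udiff_mul hb b']
  refine (hpert t a b _ _ ha hb hp hq hab (haa.trans hρ) (hbb.trans hρ) ht0 ht1).trans ?_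
  linarith

/-- One level under a change of the WEIGHT: `d(G_t(a,b), G_s(a,b)) ≤ 6|t − s|·D` — the hypothesis `hlip` read at `‖ba* − 1‖ ≤ D ≤ 1/3`.
[cite: Balaban1985Averaging, (24)-(27) pp.21-22] -/
theorem level_lip
    (hlip : ∀ (t s : ℝ) (a b : Matrix n n ℂ), a ∈ Matrix.unitaryGroup n ℂ → b ∈ Matrix.unitaryGroup n ℂ → ‖b * star a - 1‖ ≤ 1 / 3 →
      |t - s| ≤ 1 → ‖G t a b * star (G s a b) - 1‖ ≤ 6 * |t - s| * ‖b * star a - 1‖)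
    {a b : Matrix n n ℂ} (ha : a ∈ Matrix.unitaryGroup n ℂ) (hb : b ∈ Matrix.unitaryGroup n ℂ) {D : ℝ} (hD : D ≤ 1 / 3)
    (hab : ‖b * star a - 1‖ ≤ D) {t s : ℝ} (hts : |t - s| ≤ 1) :
    ‖G t a b * star (G s a b) - 1‖ ≤ 6 * |t - s| * D := by
  refine (hlip t s a b ha hb (hab.trans hD) hts).trans ?_
  gcongr

end Level

/-! ## §3 The trilinear blend of eight pairwise close unitaries -/

section Blend

variable (G : ℝ → Matrix n n ℂ → Matrix n n ℂ → Matrix n n ℂ)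

/-- **THE BLEND IS UNITARY** when the eight inputs are unitary and pairwise `D`-close with `D ≤ 1/507` (the level diameters are `D, 13D, 169D ≤ 1/3`);
moreover the two level-2 values are `169D`-close and the four level-1 values pairwise `13D`-close. [cite: Balaban1985Averaging, (23)-(27) pp.21-22] -/
theorem blend_mem_unitaryGroup
    (hmem : ∀ (t : ℝ) (a b : Matrix n n ℂ), a ∈ Matrix.unitaryGroup n ℂ → b ∈ Matrix.unitaryGroup n ℂ → ‖b * star a - 1‖ ≤ 1 / 3 →
      G t a b ∈ Matrix.unitaryGroup n ℂ)
    (hnear : ∀ (t : ℝ) (a b : Matrix n n ℂ), a ∈ Matrix.unitaryGroup n ℂ → b ∈ Matrix.unitaryGroup n ℂ → ‖b * star a - 1‖ ≤ 1 / 3 → |t| ≤ 1 →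
      ‖G t a b * star a - 1‖ ≤ 6 * |t| * ‖b * star a - 1‖)
    (v : Fin 2 → Fin 2 → Fin 2 → Matrix n n ℂ) (hv : ∀ i j k, v i j k ∈ Matrix.unitaryGroup n ℂ) {D : ℝ} (hD : D ≤ 1 / 507)
    (hvv : ∀ i j k i' j' k', ‖v i j k * star (v i' j' k') - 1‖ ≤ D) {t₁ t₂ : ℝ} (t₃ : ℝ)
    (h₁0 : 0 ≤ t₁) (h₁1 : t₁ ≤ 1) (h₂0 : 0 ≤ t₂) (h₂1 : t₂ ≤ 1) :
    (∀ j k, G t₁ (v 0 j k) (v 1 j k) ∈ Matrix.unitaryGroup n ℂ) ∧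
    (∀ j k j' k', ‖G t₁ (v 0 j k) (v 1 j k) * star (G t₁ (v 0 j' k') (v 1 j' k')) - 1‖ ≤ 13 * D) ∧
    (∀ k, G t₂ (G t₁ (v 0 0 k) (v 1 0 k)) (G t₁ (v 0 1 k) (v 1 1 k)) ∈ Matrix.unitaryGroup n ℂ) ∧
    ‖G t₂ (G t₁ (v 0 0 0) (v 1 0 0)) (G t₁ (v 0 1 0) (v 1 1 0)) * star (G t₂ (G t₁ (v 0 0 1) (v 1 0 1)) (G t₁ (v 0 1 1) (v 1 1 1))) - 1‖ ≤ 169 * D ∧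
    G t₃ (G t₂ (G t₁ (v 0 0 0) (v 1 0 0)) (G t₁ (v 0 1 0) (v 1 1 0))) (G t₂ (G t₁ (v 0 0 1) (v 1 0 1)) (G t₁ (v 0 1 1) (v 1 1 1))) ∈
      Matrix.unitaryGroup n ℂ := by
  have hD3 : D ≤ 1 / 3 := hD.trans (by norm_num)
  have hD13 : 13 * D ≤ 1 / 3 := by linarith
  have hD169 : 169 * D ≤ 1 / 3 := by linarith
  -- level 1
  have hA : ∀ j k, G t₁ (v 0 j k) (v 1 j k) ∈ Matrix.unitaryGroup n ℂ := fun j k =>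
    hmem t₁ _ _ (hv 0 j k) (hv 1 j k) ((hvv 1 j k 0 j k).trans hD3)
  have hAA : ∀ j k j' k', ‖G t₁ (v 0 j k) (v 1 j k) * star (G t₁ (v 0 j' k') (v 1 j' k')) - 1‖ ≤ 13 * D := fun j k j' k' =>
    level_diam G hmem hnear (hv 0 j k) (hv 1 j k) (hv 0 j' k') (hv 1 j' k') hD3 (hvv 1 j k 0 j k) (hvv 1 j' k' 0 j' k') (hvv 0 j k 0 j' k') h₁0 h₁1
  -- level 2
  have hB : ∀ k, G t₂ (G t₁ (v 0 0 k) (v 1 0 k)) (G t₁ (v 0 1 k) (v 1 1 k)) ∈ Matrix.unitaryGroup n ℂ := fun k =>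
    hmem t₂ _ _ (hA 0 k) (hA 1 k) ((hAA 1 k 0 k).trans hD13)
  have hBB : ‖G t₂ (G t₁ (v 0 0 0) (v 1 0 0)) (G t₁ (v 0 1 0) (v 1 1 0)) *
      star (G t₂ (G t₁ (v 0 0 1) (v 1 0 1)) (G t₁ (v 0 1 1) (v 1 1 1))) - 1‖ ≤ 169 * D := by
    have h := level_diam G hmem hnear (hA 0 0) (hA 1 0) (hA 0 1) (hA 1 1) hD13 (hAA 1 0 0 0) (hAA 1 1 0 1) (hAA 0 0 0 1) h₂0 h₂1
    linarith
  refine ⟨hA, hAA, hB, hBB, ?_⟩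
  exact hmem t₃ _ _ (hB 0) (hB 1) (by rw [udist_symm]; exact hBB.trans hD169)

/-- **THE BLEND IS SPECIAL UNITARY** under the same smallness, for a scheme with `G_t(a,b) ∈ SU(N)` whenever `a, b ∈ SU(N)` are `1/3`-close with
`N‖ba* − 1‖ < π` (here guaranteed by `N·169D < π`). [cite: Balaban1985Averaging, (23) p.21] -/
theorem blend_mem_specialUnitaryGroup
    (hmem : ∀ (t : ℝ) (a b : Matrix n n ℂ), a ∈ Matrix.unitaryGroup n ℂ → b ∈ Matrix.unitaryGroup n ℂ → ‖b * star a - 1‖ ≤ 1 / 3 →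
      G t a b ∈ Matrix.unitaryGroup n ℂ)
    (hmemSU : ∀ (t : ℝ) (a b : Matrix n n ℂ), a ∈ Matrix.specialUnitaryGroup n ℂ → b ∈ Matrix.specialUnitaryGroup n ℂ → ‖b * star a - 1‖ ≤ 1 / 3 →
      Fintype.card n * ‖b * star a - 1‖ < Real.pi → G t a b ∈ Matrix.specialUnitaryGroup n ℂ)
    (hnear : ∀ (t : ℝ) (a b : Matrix n n ℂ), a ∈ Matrix.unitaryGroup n ℂ → b ∈ Matrix.unitaryGroup n ℂ → ‖b * star a - 1‖ ≤ 1 / 3 → |t| ≤ 1 →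
      ‖G t a b * star a - 1‖ ≤ 6 * |t| * ‖b * star a - 1‖)
    (v : Fin 2 → Fin 2 → Fin 2 → Matrix n n ℂ) (hv : ∀ i j k, v i j k ∈ Matrix.specialUnitaryGroup n ℂ) {D : ℝ} (hD : D ≤ 1 / 507)
    (hDπ : Fintype.card n * (169 * D) < Real.pi)
    (hvv : ∀ i j k i' j' k', ‖v i j k * star (v i' j' k') - 1‖ ≤ D) {t₁ t₂ : ℝ} (t₃ : ℝ)
    (h₁0 : 0 ≤ t₁) (h₁1 : t₁ ≤ 1) (h₂0 : 0 ≤ t₂) (h₂1 : t₂ ≤ 1) :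
    G t₃ (G t₂ (G t₁ (v 0 0 0) (v 1 0 0)) (G t₁ (v 0 1 0) (v 1 1 0))) (G t₂ (G t₁ (v 0 0 1) (v 1 0 1)) (G t₁ (v 0 1 1) (v 1 1 1))) ∈
      Matrix.specialUnitaryGroup n ℂ := by
  have hvU : ∀ i j k, v i j k ∈ Matrix.unitaryGroup n ℂ := fun i j k => (Matrix.mem_specialUnitaryGroup_iff.1 (hv i j k)).1
  obtain ⟨-, hAA, -, hBB, -⟩ := blend_mem_unitaryGroup G hmem hnear v hvU hD hvv t₃ h₁0 h₁1 h₂0 h₂1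
  have hD0 : 0 ≤ D := (norm_nonneg _).trans (hvv 0 0 0 0 0 0)
  have hD3 : D ≤ 1 / 3 := hD.trans (by norm_num)
  have hD13 : 13 * D ≤ 1 / 3 := by linarith
  have hD169 : 169 * D ≤ 1 / 3 := by linarith
  have hN : (0 : ℝ) ≤ Fintype.card n := Nat.cast_nonneg _
  have hπ_of : ∀ {x : ℝ}, x ≤ 169 * D → Fintype.card n * x < Real.pi := fun hx =>
    lt_of_le_of_lt (mul_le_mul_of_nonneg_left hx hN) hDπ
  have hA : ∀ j k, G t₁ (v 0 j k) (v 1 j k) ∈ Matrix.specialUnitaryGroup n ℂ := fun j k =>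
    hmemSU t₁ _ _ (hv 0 j k) (hv 1 j k) ((hvv 1 j k 0 j k).trans hD3) (hπ_of ((hvv 1 j k 0 j k).trans (by linarith)))
  have hB : ∀ k, G t₂ (G t₁ (v 0 0 k) (v 1 0 k)) (G t₁ (v 0 1 k) (v 1 1 k)) ∈ Matrix.specialUnitaryGroup n ℂ := fun k =>
    hmemSU t₂ _ _ (hA 0 k) (hA 1 k) ((hAA 1 k 0 k).trans hD13) (hπ_of ((hAA 1 k 0 k).trans (by linarith)))
  have hBB' := (udist_symm _ _).le.trans hBB
  exact hmemSU t₃ _ _ (hB 0) (hB 1) (hBB'.trans hD169) (hπ_of hBB')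

omit [Fintype n] [DecidableEq n] in
/-- **THE BLEND AT A CENTRE**: `t = (0,0,0)` ⟹ `B = v₀₀₀` — with the comb element of the own centre equal to `1` there, the blend is `1` at every
`k`-fold centre: it lies in print's group (4). [cite: Balaban1985Variational, (4) p.278] -/
theorem blend_corner (h0 : ∀ a b : Matrix n n ℂ, G 0 a b = a) (v : Fin 2 → Fin 2 → Fin 2 → Matrix n n ℂ) :
    G 0 (G 0 (G 0 (v 0 0 0) (v 1 0 0)) (G 0 (v 0 1 0) (v 1 1 0))) (G 0 (G 0 (v 0 0 1) (v 1 0 1)) (G 0 (v 0 1 1) (v 1 1 1))) = v 0 0 0 := by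
  simp only [h0]

omit [Fintype n] [DecidableEq n] in
/-- Face value `t₁ = 0`: the blend is the bilinear blend of the four corners `v₀ⱼₖ`. [folklore] -/
theorem blend_face₁₀ (h0 : ∀ a b : Matrix n n ℂ, G 0 a b = a) (v : Fin 2 → Fin 2 → Fin 2 → Matrix n n ℂ) (t₂ t₃ : ℝ) :
    G t₃ (G t₂ (G 0 (v 0 0 0) (v 1 0 0)) (G 0 (v 0 1 0) (v 1 1 0))) (G t₂ (G 0 (v 0 0 1) (v 1 0 1)) (G 0 (v 0 1 1) (v 1 1 1))) =
      G t₃ (G t₂ (v 0 0 0) (v 0 1 0)) (G t₂ (v 0 0 1) (v 0 1 1)) := by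
  simp only [h0]

/-- Face value `t₁ = 1`: the blend is the bilinear blend of the four corners `v₁ⱼₖ` (the `t₁ = 0` face value of the NEXT cell of centres in direction 1:
the blend is single-valued across cells). [folklore] -/
theorem blend_face₁₁ (h1 : ∀ a b : Matrix n n ℂ, a ∈ Matrix.unitaryGroup n ℂ → ‖b * star a - 1‖ < 1 → G 1 a b = b)
    (v : Fin 2 → Fin 2 → Fin 2 → Matrix n n ℂ) (hv : ∀ i j k, v i j k ∈ Matrix.unitaryGroup n ℂ)
    (hvv : ∀ j k, ‖v 1 j k * star (v 0 j k) - 1‖ < 1) (t₂ t₃ : ℝ) :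
    G t₃ (G t₂ (G 1 (v 0 0 0) (v 1 0 0)) (G 1 (v 0 1 0) (v 1 1 0))) (G t₂ (G 1 (v 0 0 1) (v 1 0 1)) (G 1 (v 0 1 1) (v 1 1 1))) =
      G t₃ (G t₂ (v 1 0 0) (v 1 1 0)) (G t₂ (v 1 0 1) (v 1 1 1)) := by
  simp only [h1 _ _ (hv 0 _ _) (hvv _ _)]

omit [Fintype n] [DecidableEq n] in
/-- Face value `t₂ = 0`. [folklore] -/
theorem blend_face₂₀ (h0 : ∀ a b : Matrix n n ℂ, G 0 a b = a) (v : Fin 2 → Fin 2 → Fin 2 → Matrix n n ℂ) (t₁ t₃ : ℝ) :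
    G t₃ (G 0 (G t₁ (v 0 0 0) (v 1 0 0)) (G t₁ (v 0 1 0) (v 1 1 0))) (G 0 (G t₁ (v 0 0 1) (v 1 0 1)) (G t₁ (v 0 1 1) (v 1 1 1))) =
      G t₃ (G t₁ (v 0 0 0) (v 1 0 0)) (G t₁ (v 0 0 1) (v 1 0 1)) := by
  simp only [h0]

/-- Face value `t₂ = 1` (needs the level-1 values unitary and `< 1`-close, e.g. from `blend_mem_unitaryGroup`). [folklore] -/
theorem blend_face₂₁ (h1 : ∀ a b : Matrix n n ℂ, a ∈ Matrix.unitaryGroup n ℂ → ‖b * star a - 1‖ < 1 → G 1 a b = b)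
    (v : Fin 2 → Fin 2 → Fin 2 → Matrix n n ℂ) {t₁ : ℝ} (hA : ∀ k, G t₁ (v 0 0 k) (v 1 0 k) ∈ Matrix.unitaryGroup n ℂ)
    (hAA : ∀ k, ‖G t₁ (v 0 1 k) (v 1 1 k) * star (G t₁ (v 0 0 k) (v 1 0 k)) - 1‖ < 1) (t₃ : ℝ) :
    G t₃ (G 1 (G t₁ (v 0 0 0) (v 1 0 0)) (G t₁ (v 0 1 0) (v 1 1 0))) (G 1 (G t₁ (v 0 0 1) (v 1 0 1)) (G t₁ (v 0 1 1) (v 1 1 1))) =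
      G t₃ (G t₁ (v 0 1 0) (v 1 1 0)) (G t₁ (v 0 1 1) (v 1 1 1)) := by
  rw [h1 _ _ (hA 0) (hAA 0), h1 _ _ (hA 1) (hAA 1)]

omit [Fintype n] [DecidableEq n] in
/-- Face value `t₃ = 0`. [folklore] -/
theorem blend_face₃₀ (h0 : ∀ a b : Matrix n n ℂ, G 0 a b = a) (v : Fin 2 → Fin 2 → Fin 2 → Matrix n n ℂ) (t₁ t₂ : ℝ) :
    G 0 (G t₂ (G t₁ (v 0 0 0) (v 1 0 0)) (G t₁ (v 0 1 0) (v 1 1 0))) (G t₂ (G t₁ (v 0 0 1) (v 1 0 1)) (G t₁ (v 0 1 1) (v 1 1 1))) =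
      G t₂ (G t₁ (v 0 0 0) (v 1 0 0)) (G t₁ (v 0 1 0) (v 1 1 0)) := h0 _ _

/-- Face value `t₃ = 1` (needs the level-2 values unitary and `< 1`-close). [folklore] -/
theorem blend_face₃₁ (h1 : ∀ a b : Matrix n n ℂ, a ∈ Matrix.unitaryGroup n ℂ → ‖b * star a - 1‖ < 1 → G 1 a b = b)
    (v : Fin 2 → Fin 2 → Fin 2 → Matrix n n ℂ) {t₁ t₂ : ℝ} (hB : G t₂ (G t₁ (v 0 0 0) (v 1 0 0)) (G t₁ (v 0 1 0) (v 1 1 0)) ∈ Matrix.unitaryGroup n ℂ)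
    (hBB : ‖G t₂ (G t₁ (v 0 0 1) (v 1 0 1)) (G t₁ (v 0 1 1) (v 1 1 1)) * star (G t₂ (G t₁ (v 0 0 0) (v 1 0 0)) (G t₁ (v 0 1 0) (v 1 1 0))) - 1‖ < 1) :
    G 1 (G t₂ (G t₁ (v 0 0 0) (v 1 0 0)) (G t₁ (v 0 1 0) (v 1 1 0))) (G t₂ (G t₁ (v 0 0 1) (v 1 0 1)) (G t₁ (v 0 1 1) (v 1 1 1))) =
      G t₂ (G t₁ (v 0 0 1) (v 1 0 1)) (G t₁ (v 0 1 1) (v 1 1 1)) := h1 _ _ hB hBB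

/-- **EQUIVARIANCE OF THE BLEND** under a simultaneous two-sided unitary translation of the eight inputs: `B(t; u·v·w) = u·B(t; v)·w` — the law that
turns the comb elements at the two ends of a bond into each other ([Balaban1985Averaging] (8)). [cite: Balaban1985Averaging, (8) p.18, Sect. B p.24] -/
theorem blend_conj (hconj : ∀ (t : ℝ) (u w a b : Matrix n n ℂ), u ∈ Matrix.unitaryGroup n ℂ → w ∈ Matrix.unitaryGroup n ℂ →
      G t (u * a * w) (u * b * w) = u * G t a b * w)
    {u w : Matrix n n ℂ} (hu : u ∈ Matrix.unitaryGroup n ℂ) (hw : w ∈ Matrix.unitaryGroup n ℂ) (v : Fin 2 → Fin 2 → Fin 2 → Matrix n n ℂ)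
    (t₁ t₂ t₃ : ℝ) :
    G t₃ (G t₂ (G t₁ (u * v 0 0 0 * w) (u * v 1 0 0 * w)) (G t₁ (u * v 0 1 0 * w) (u * v 1 1 0 * w)))
        (G t₂ (G t₁ (u * v 0 0 1 * w) (u * v 1 0 1 * w)) (G t₁ (u * v 0 1 1 * w) (u * v 1 1 1 * w))) =
      u * G t₃ (G t₂ (G t₁ (v 0 0 0) (v 1 0 0)) (G t₁ (v 0 1 0) (v 1 1 0))) (G t₂ (G t₁ (v 0 0 1) (v 1 0 1)) (G t₁ (v 0 1 1) (v 1 1 1))) * w := by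
  simp only [hconj _ _ _ _ _ hu hw]

/-- Three-step triangle inequality on `U(N)`. [folklore] -/
theorem udist_triangle₃ {X Y Z : Matrix n n ℂ} (hX : X ∈ Matrix.unitaryGroup n ℂ) (hY : Y ∈ Matrix.unitaryGroup n ℂ)
    (hZ : Z ∈ Matrix.unitaryGroup n ℂ) (T : Matrix n n ℂ) : ‖X * star T - 1‖ ≤ ‖X * star Y - 1‖ + ‖Y * star Z - 1‖ + ‖Z * star T - 1‖ := by
  linarith [udist_triangle hX hY T, udist_triangle hY hZ T]

/-- **LIPSCHITZ IN THE WEIGHTS**: eight pairwise `D`-close unitaries, `D ≤ 1/1600`, weights `t, t′ ∈ [0,1]³` ⟹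
`d(B(t; v), B(t′; v)) ≤ 1600·(|t₁ − t₁′| + |t₂ − t₂′| + |t₃ − t₃′|)·D`.  (Level by level: a change of `t₁` moves the level-1 values by `6|Δt₁|D`, hence the
level-2 values by `16·6|Δt₁|D` and the blend by `16²·6|Δt₁|D = 1536|Δt₁|D`; a change of `t₂` costs `16·6|Δt₂|·13D = 1248|Δt₂|D`; of `t₃`, `6|Δt₃|·169D`.)
[cite: Balaban1985Averaging, (21)-(27) pp.21-22] -/
theorem blend_lip_weights
    (hmem : ∀ (t : ℝ) (a b : Matrix n n ℂ), a ∈ Matrix.unitaryGroup n ℂ → b ∈ Matrix.unitaryGroup n ℂ → ‖b * star a - 1‖ ≤ 1 / 3 →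
      G t a b ∈ Matrix.unitaryGroup n ℂ)
    (hnear : ∀ (t : ℝ) (a b : Matrix n n ℂ), a ∈ Matrix.unitaryGroup n ℂ → b ∈ Matrix.unitaryGroup n ℂ → ‖b * star a - 1‖ ≤ 1 / 3 → |t| ≤ 1 →
      ‖G t a b * star a - 1‖ ≤ 6 * |t| * ‖b * star a - 1‖)
    (hlip : ∀ (t s : ℝ) (a b : Matrix n n ℂ), a ∈ Matrix.unitaryGroup n ℂ → b ∈ Matrix.unitaryGroup n ℂ → ‖b * star a - 1‖ ≤ 1 / 3 →
      |t - s| ≤ 1 → ‖G t a b * star (G s a b) - 1‖ ≤ 6 * |t - s| * ‖b * star a - 1‖)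
    (hpert : ∀ (t : ℝ) (a b p q : Matrix n n ℂ), a ∈ Matrix.unitaryGroup n ℂ → b ∈ Matrix.unitaryGroup n ℂ →
      p ∈ Matrix.unitaryGroup n ℂ → q ∈ Matrix.unitaryGroup n ℂ → ‖b * star a - 1‖ ≤ 1 / 6 → ‖p - 1‖ ≤ 1 / 16 → ‖q - 1‖ ≤ 1 / 16 →
      0 ≤ t → t ≤ 1 → ‖G t (p * a) (q * b) * star (G t a b) - 1‖ ≤ 8 * (‖p - 1‖ + ‖q - 1‖))
    (v : Fin 2 → Fin 2 → Fin 2 → Matrix n n ℂ) (hv : ∀ i j k, v i j k ∈ Matrix.unitaryGroup n ℂ) {D : ℝ} (hD : D ≤ 1 / 1600)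
    (hvv : ∀ i j k i' j' k', ‖v i j k * star (v i' j' k') - 1‖ ≤ D) {t₁ t₂ t₃ s₁ s₂ s₃ : ℝ}
    (h₁0 : 0 ≤ t₁) (h₁1 : t₁ ≤ 1) (h₂0 : 0 ≤ t₂) (h₂1 : t₂ ≤ 1) (h₃0 : 0 ≤ t₃) (h₃1 : t₃ ≤ 1)
    (hs₁0 : 0 ≤ s₁) (hs₁1 : s₁ ≤ 1) (hs₂0 : 0 ≤ s₂) (hs₂1 : s₂ ≤ 1) (hs₃0 : 0 ≤ s₃) (hs₃1 : s₃ ≤ 1) :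
    ‖G t₃ (G t₂ (G t₁ (v 0 0 0) (v 1 0 0)) (G t₁ (v 0 1 0) (v 1 1 0))) (G t₂ (G t₁ (v 0 0 1) (v 1 0 1)) (G t₁ (v 0 1 1) (v 1 1 1))) *
        star (G s₃ (G s₂ (G s₁ (v 0 0 0) (v 1 0 0)) (G s₁ (v 0 1 0) (v 1 1 0))) (G s₂ (G s₁ (v 0 0 1) (v 1 0 1)) (G s₁ (v 0 1 1) (v 1 1 1)))) - 1‖ ≤
      1600 * (|t₁ - s₁| + |t₂ - s₂| + |t₃ - s₃|) * D := by
  have hD0 : 0 ≤ D := (norm_nonneg _).trans (hvv 0 0 0 0 0 0)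
  have hD507 : D ≤ 1 / 507 := hD.trans (by norm_num)
  have hD3 : D ≤ 1 / 3 := hD.trans (by norm_num)
  have hD13 : 13 * D ≤ 1 / 3 := by linarith
  have hD13' : 13 * D ≤ 1 / 6 := by linarith
  have hD169' : 169 * D ≤ 1 / 6 := by linarith
  have hΔ₁ : |t₁ - s₁| ≤ 1 := by rw [abs_le]; constructor <;> linarith
  have hΔ₂ : |t₂ - s₂| ≤ 1 := by rw [abs_le]; constructor <;> linarith
  have hΔ₃ : |t₃ - s₃| ≤ 1 := by rw [abs_le]; constructor <;> linarith
  -- the level data at weights `t` and at weights `s`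
  obtain ⟨hAt, hAAt, hBt, hBBt, hCt⟩ := blend_mem_unitaryGroup G hmem hnear v hv hD507 hvv t₃ h₁0 h₁1 h₂0 h₂1
  obtain ⟨hAs, hAAs, hBs, hBBs, -⟩ := blend_mem_unitaryGroup G hmem hnear v hv hD507 hvv s₃ hs₁0 hs₁1 hs₂0 hs₂1
  -- mixed weights `(s₁, t₂, ·)` and `(s₁, s₂, ·)`
  obtain ⟨-, -, hBst, hBBst, hCst⟩ := blend_mem_unitaryGroup G hmem hnear v hv hD507 hvv t₃ hs₁0 hs₁1 h₂0 h₂1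
  obtain ⟨-, -, -, -, hCsst⟩ := blend_mem_unitaryGroup G hmem hnear v hv hD507 hvv t₃ hs₁0 hs₁1 hs₂0 hs₂1
  -- STEP 1: change `t₁ → s₁` (levels 2, 3 at `t₂, t₃`)
  have hρ₁ : ∀ j k, ‖G t₁ (v 0 j k) (v 1 j k) * star (G s₁ (v 0 j k) (v 1 j k)) - 1‖ ≤ 6 * |t₁ - s₁| * D := fun j k =>
    level_lip G hlip (hv 0 j k) (hv 1 j k) hD3 (hvv 1 j k 0 j k) hΔ₁
  have hρ₁b : 6 * |t₁ - s₁| * D ≤ 1 / 16 := by nlinarith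
  have hlev2 : ∀ k, ‖G t₂ (G t₁ (v 0 0 k) (v 1 0 k)) (G t₁ (v 0 1 k) (v 1 1 k)) *
      star (G t₂ (G s₁ (v 0 0 k) (v 1 0 k)) (G s₁ (v 0 1 k) (v 1 1 k))) - 1‖ ≤ 16 * (6 * |t₁ - s₁| * D) := fun k =>
    level_pert G hpert (hAs 0 k) (hAs 1 k) (hAt 0 k) (hAt 1 k) ((hAAs 1 k 0 k).trans hD13') hρ₁b (hρ₁ 0 k) (hρ₁ 1 k) h₂0 h₂1
  have hρ₂b : 16 * (6 * |t₁ - s₁| * D) ≤ 1 / 16 := by nlinarith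
  have hstep1 : ‖G t₃ (G t₂ (G t₁ (v 0 0 0) (v 1 0 0)) (G t₁ (v 0 1 0) (v 1 1 0))) (G t₂ (G t₁ (v 0 0 1) (v 1 0 1)) (G t₁ (v 0 1 1) (v 1 1 1))) *
      star (G t₃ (G t₂ (G s₁ (v 0 0 0) (v 1 0 0)) (G s₁ (v 0 1 0) (v 1 1 0))) (G t₂ (G s₁ (v 0 0 1) (v 1 0 1)) (G s₁ (v 0 1 1) (v 1 1 1)))) - 1‖ ≤
      16 * (16 * (6 * |t₁ - s₁| * D)) :=
    level_pert G hpert (hBst 0) (hBst 1) (hBt 0) (hBt 1) ((udist_symm _ _).le.trans (hBBst.trans hD169')) hρ₂b (hlev2 0) (hlev2 1) h₃0 h₃1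
  -- STEP 2: change `t₂ → s₂` (level 1 at `s₁`, level 3 at `t₃`)
  have hσ : ∀ k, ‖G t₂ (G s₁ (v 0 0 k) (v 1 0 k)) (G s₁ (v 0 1 k) (v 1 1 k)) *
      star (G s₂ (G s₁ (v 0 0 k) (v 1 0 k)) (G s₁ (v 0 1 k) (v 1 1 k))) - 1‖ ≤ 6 * |t₂ - s₂| * (13 * D) := fun k =>
    level_lip G hlip (hAs 0 k) (hAs 1 k) hD13 (hAAs 1 k 0 k) hΔ₂
  have hσb : 6 * |t₂ - s₂| * (13 * D) ≤ 1 / 16 := by nlinarith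
  have hstep2 : ‖G t₃ (G t₂ (G s₁ (v 0 0 0) (v 1 0 0)) (G s₁ (v 0 1 0) (v 1 1 0))) (G t₂ (G s₁ (v 0 0 1) (v 1 0 1)) (G s₁ (v 0 1 1) (v 1 1 1))) *
      star (G t₃ (G s₂ (G s₁ (v 0 0 0) (v 1 0 0)) (G s₁ (v 0 1 0) (v 1 1 0))) (G s₂ (G s₁ (v 0 0 1) (v 1 0 1)) (G s₁ (v 0 1 1) (v 1 1 1)))) - 1‖ ≤
      16 * (6 * |t₂ - s₂| * (13 * D)) :=
    level_pert G hpert (hBs 0) (hBs 1) (hBst 0) (hBst 1) ((udist_symm _ _).le.trans (hBBs.trans hD169')) hσb (hσ 0) (hσ 1) h₃0 h₃1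
  -- STEP 3: change `t₃ → s₃`
  have hstep3 : ‖G t₃ (G s₂ (G s₁ (v 0 0 0) (v 1 0 0)) (G s₁ (v 0 1 0) (v 1 1 0))) (G s₂ (G s₁ (v 0 0 1) (v 1 0 1)) (G s₁ (v 0 1 1) (v 1 1 1))) *
      star (G s₃ (G s₂ (G s₁ (v 0 0 0) (v 1 0 0)) (G s₁ (v 0 1 0) (v 1 1 0))) (G s₂ (G s₁ (v 0 0 1) (v 1 0 1)) (G s₁ (v 0 1 1) (v 1 1 1)))) - 1‖ ≤
      6 * |t₃ - s₃| * (169 * D) :=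
    level_lip G hlip (hBs 0) (hBs 1) (by linarith) ((udist_symm _ _).le.trans hBBs) hΔ₃
  -- assemble
  have h := udist_triangle₃ hCt hCst hCsst
    (G s₃ (G s₂ (G s₁ (v 0 0 0) (v 1 0 0)) (G s₁ (v 0 1 0) (v 1 1 0))) (G s₂ (G s₁ (v 0 0 1) (v 1 0 1)) (G s₁ (v 0 1 1) (v 1 1 1))))
  nlinarith [abs_nonneg (t₁ - s₁), abs_nonneg (t₂ - s₂), abs_nonneg (t₃ - s₃)]

/-- **LIPSCHITZ IN THE INPUTS**: two families of eight unitaries, each pairwise `D`-close (`D ≤ 1/1014`), with `d(v′_α, v_α) ≤ ρ ≤ 1/4096` for every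
corner ⟹ `d(B(t; v′), B(t; v)) ≤ 4096ρ` (`16ρ` after level 1, `256ρ` after level 2, `4096ρ` after level 3). [cite: Balaban1985Averaging, (21)-(27) pp.21-22] -/
theorem blend_lip_inputs
    (hmem : ∀ (t : ℝ) (a b : Matrix n n ℂ), a ∈ Matrix.unitaryGroup n ℂ → b ∈ Matrix.unitaryGroup n ℂ → ‖b * star a - 1‖ ≤ 1 / 3 →
      G t a b ∈ Matrix.unitaryGroup n ℂ)
    (hnear : ∀ (t : ℝ) (a b : Matrix n n ℂ), a ∈ Matrix.unitaryGroup n ℂ → b ∈ Matrix.unitaryGroup n ℂ → ‖b * star a - 1‖ ≤ 1 / 3 → |t| ≤ 1 →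
      ‖G t a b * star a - 1‖ ≤ 6 * |t| * ‖b * star a - 1‖)
    (hpert : ∀ (t : ℝ) (a b p q : Matrix n n ℂ), a ∈ Matrix.unitaryGroup n ℂ → b ∈ Matrix.unitaryGroup n ℂ →
      p ∈ Matrix.unitaryGroup n ℂ → q ∈ Matrix.unitaryGroup n ℂ → ‖b * star a - 1‖ ≤ 1 / 6 → ‖p - 1‖ ≤ 1 / 16 → ‖q - 1‖ ≤ 1 / 16 →
      0 ≤ t → t ≤ 1 → ‖G t (p * a) (q * b) * star (G t a b) - 1‖ ≤ 8 * (‖p - 1‖ + ‖q - 1‖))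
    (v v' : Fin 2 → Fin 2 → Fin 2 → Matrix n n ℂ) (hv : ∀ i j k, v i j k ∈ Matrix.unitaryGroup n ℂ) (hv' : ∀ i j k, v' i j k ∈ Matrix.unitaryGroup n ℂ)
    {D : ℝ} (hD : D ≤ 1 / 1014) (hvv : ∀ i j k i' j' k', ‖v i j k * star (v i' j' k') - 1‖ ≤ D)
    (hvv' : ∀ i j k i' j' k', ‖v' i j k * star (v' i' j' k') - 1‖ ≤ D) {ρ : ℝ} (hρ : ρ ≤ 1 / 4096)
    (hclose : ∀ i j k, ‖v' i j k * star (v i j k) - 1‖ ≤ ρ) {t₁ t₂ t₃ : ℝ}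
    (h₁0 : 0 ≤ t₁) (h₁1 : t₁ ≤ 1) (h₂0 : 0 ≤ t₂) (h₂1 : t₂ ≤ 1) (h₃0 : 0 ≤ t₃) (h₃1 : t₃ ≤ 1) :
    ‖G t₃ (G t₂ (G t₁ (v' 0 0 0) (v' 1 0 0)) (G t₁ (v' 0 1 0) (v' 1 1 0))) (G t₂ (G t₁ (v' 0 0 1) (v' 1 0 1)) (G t₁ (v' 0 1 1) (v' 1 1 1))) *
        star (G t₃ (G t₂ (G t₁ (v 0 0 0) (v 1 0 0)) (G t₁ (v 0 1 0) (v 1 1 0))) (G t₂ (G t₁ (v 0 0 1) (v 1 0 1)) (G t₁ (v 0 1 1) (v 1 1 1)))) - 1‖ ≤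
      4096 * ρ := by
  have hD507 : D ≤ 1 / 507 := hD.trans (by norm_num)
  have hD0 : 0 ≤ D := (norm_nonneg _).trans (hvv 0 0 0 0 0 0)
  have hD6 : D ≤ 1 / 6 := hD.trans (by norm_num)
  have hD13 : 13 * D ≤ 1 / 6 := by linarith
  have hD169 : 169 * D ≤ 1 / 6 := by linarith
  obtain ⟨hA, hAA, hB, hBB, -⟩ := blend_mem_unitaryGroup G hmem hnear v hv hD507 hvv t₃ h₁0 h₁1 h₂0 h₂1
  obtain ⟨hA', hAA', hB', -, -⟩ := blend_mem_unitaryGroup G hmem hnear v' hv' hD507 hvv' t₃ h₁0 h₁1 h₂0 h₂1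
  have hρ16 : ρ ≤ 1 / 16 := hρ.trans (by norm_num)
  -- level 1
  have h1 : ∀ j k, ‖G t₁ (v' 0 j k) (v' 1 j k) * star (G t₁ (v 0 j k) (v 1 j k)) - 1‖ ≤ 16 * ρ := fun j k =>
    level_pert G hpert (hv 0 j k) (hv 1 j k) (hv' 0 j k) (hv' 1 j k) ((hvv 1 j k 0 j k).trans hD6) hρ16 (hclose 0 j k) (hclose 1 j k) h₁0 h₁1
  have hρ₂ : 16 * ρ ≤ 1 / 16 := by linarith
  -- level 2
  have h2 : ∀ k, ‖G t₂ (G t₁ (v' 0 0 k) (v' 1 0 k)) (G t₁ (v' 0 1 k) (v' 1 1 k)) *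
      star (G t₂ (G t₁ (v 0 0 k) (v 1 0 k)) (G t₁ (v 0 1 k) (v 1 1 k))) - 1‖ ≤ 16 * (16 * ρ) := fun k =>
    level_pert G hpert (hA 0 k) (hA 1 k) (hA' 0 k) (hA' 1 k) ((hAA 1 k 0 k).trans hD13) hρ₂ (h1 0 k) (h1 1 k) h₂0 h₂1
  have hρ₃ : 16 * (16 * ρ) ≤ 1 / 16 := by linarith
  -- level 3
  have h3 := level_pert G hpert (hB 0) (hB 1) (hB' 0) (hB' 1) ((udist_symm _ _).le.trans (hBB.trans hD169)) hρ₃ (h2 0) (h2 1) h₃0 h₃1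
  linarith

end Blend

end Summit.QuantumFields.YangMills.Theorems.Prop7GeodesicBlend

end
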